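import Summits.QuantumFields.YangMills.Theorems.BalabanUVNodesN11NoExpansionGeneralStepCoPH
import Summits.QuantumFields.YangMills.Theorems.BalabanUVNodesN11DiagonalPinAboveZero
import Literature.MathematicalPhysics.QuantumFieldTheory.Balaban1983to89.Node00.Record13SepCoPRInhabitedOfSepCoP

/-!
# DAG node N11 — A6 WITNESS FOR THE GENERAL-HISTORY 𝐓-STEP AT THE v1.7 RECORD: at the door image of node00-def-K0a's cured witness family,
# `Stage13HParams.ofHistoryBlind (Stage13RParams.ofCured θ₀)`, along the all-large-field diagonal, EVERY displayed binder of
# `clause_succ_CoPH_of_Omega_empty_of_pinChi_of_clause` except the clause at `init s′` and the measurability ∕ bound of the new integrand is DISCHARGED —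
# (P) `rfl`, (V) K0a's pin faces with `χ_k ≡ 1`, `quad ≡ 0` (so `hq`, `hqloc`), 12b locality, and the old action's fluctuation-locality `hA` (term-free action)

Cell `pub-ymgap`, YM-PLAN Track A (HUMAN RULING D-0062), seat `pub-ymgap-dag-n11-d` (g8; R134 fan-out seat N11 [B14], strategy s2), route `BalabanUVNodes`
rev 25, item K1⁷ `StabilityBAtRecordR13SepCoPH` = stmt-QuantumFields-20542 (helper, count-neutral).  [III] = [Balaban1988Convergent].
Over this seat's `…NoExpansionGeneralStepCoPH` (p544575), `…DiagonalPinAboveZero` (p534515: `init_seqAllLargeOfRecord`), `…NoExpansionTermFree` (p495297: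
`action23_of_forall_Omega_empty`), node00-def-K0a's FILE 17∕18 (`ZrOfRecord₁₃` faces, `Stage13RParams.ofCured`, `Provisos₁₃Core.ofCured`) and node00-def-T's
FILE 27 door (`Stage13HParams.ofHistoryBlind`, `Provisos₁₃CoPR.ofHistoryBlind`).

WHY THIS FILE (director-ym №189 (3) STANDING A6 RULE).  The general step p544575 carries displayed binders (P) `hpre`, (V) `hZ`∕`hq`, `hloc`, `hqloc`, `hA`, `hid`,
`hm`∕`hC`.  This file INHABITS all of them but `hid` (supplied by `SLaw₁₃CoPH … k`, the item's own antecedent) and `hm`∕`hC` (properties of the new integrand, the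
same displayed class as in the accepted p535033 §3 ∕ p541699 §5) at a NAMED tree term: the door image of K0a's cured witness along the diagonal.  There (P) is
`rfl` (history-blind), (V) is K0a's `ZrOfRecord₁₃_ζ0_univ_pairCfgAt` once `χ_k(init s′) ≡ 1` (the old term is all-large), `hq`∕`hqloc` are `ZrOfRecord₁₃_quad`
(`quad ≡ 0`), `hloc` is `localLaws_ZrOfRecord₁₃`, and `hA` holds because along the all-`Ω`-empty `init s′` the (2.23) action is `−g₀⁻²A(U) − E` for EVERY
fluctuation argument.  So p544575's binder family is jointly satisfiable (modulo `hid`, `hm`, `hC`), and the general theorem SPECIALISES to the diagonal step — a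
consistency check of the general-history road against the diagonal road.

WHAT THIS FILE PROVES (0 `sorry`, 0 `def`, standard axioms; `N`-generic).  `chiSeqOfRecord_init_eq_one_of_allLarge` · `hA_of_allLarge` (fluctuation-locality of
the old action along an all-`Ω`-empty old term — term-free) · ★ `exists_clause_succ_CoPH_door_ofCured_of_allLarge` (the general step's ∃-form at
`ofHistoryBlind (ofCured θ₀)` along the diagonal from `θ₀.Provisos₁₃Core`, `SLaw₁₃CoPH … k`, `k < K`, `1 ≤ M` and displayed `hm`∕`hC` ONLY).

HONEST FRAMING.  Count-neutral kernel bookkeeping; an A6 satisfiability witness, not new content over p535033∕p541699 (which reach the same diagonal clause by the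
diagonal road); nothing of Bałaban's asserted; N11 NOT discharged; K1⁷ NOT closed; counts unmoved (typed 28∕28 · discharged 5∕28).  One finite four-torus
programme at fixed `ε = L^{−K}`; NOT ℝ⁴, NOT OS, NOT a mass gap, NOT Clay.
Sources: [III] Theorem p.245, (2.18) p.257, (2.20)–(2.25) pp.258–259, (3.16) p.268, (3.24)–(3.25) p.270, p.267, (1.11) p.248.
-/

noncomputable section

open MeasureTheory
open scoped BigOperators Matrix.Norms.L2Operator

namespace Summit.QuantumFields.YangMills.Theorems.BalabanUVNodesN11NoExpansionGeneralStepCoPHDoor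

open Literature.MathematicalPhysics.QuantumFieldTheory.Balaban1983to89 T4Continuum Node00 Node00.Tk DagBinding
open B15DeterminingSets
open BalabanUVNodesN11NoExpansionTermFree (action23_of_forall_Omega_empty)
open BalabanUVNodesN11NoExpansionAllLargeCoP (init_allLarge)
open BalabanUVNodesN11NoExpansionGeneralStepCoPH (exists_clause_succ_CoPH_of_Omega_empty_of_sLaw₁₃CoPH)

variable {F : T4Family} {N : ℕ} [NeZero N]

section Door

variable (θ₀ : Stage13Params F N) (p : B12.RunParams)

/-- Along an all-large-field new sequence of length `k+1` the OLD front factor is trivial: `χ_k(init s′) ≡ 1`. [cite: Balaban1988Convergent, (2.17)–(2.18) p.257 (bookkeeping)] -/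
theorem chiSeqOfRecord_init_eq_one_of_allLarge {k : ℕ} (s : SeqOfRecord F θ₀.ν θ₀.τ9.M (gOfRecord₁₃ F N θ₀ p) p.K (k + 1))
    (hall : ∀ j, 1 ≤ j → j ≤ k + 1 → s.Ω j = ∅) (U₀ : GaugeField (F.P p.K) k (SU N)) :
    chiSeqOfRecord F N θ₀.ν θ₀.τ9.M (gOfRecord₁₃ F N θ₀ p) p.K k s.init U₀ = 1 := by
  rcases Nat.eq_zero_or_pos k with hk0 | hkpos
  · subst hk0; exact chiSeqOfRecord_zero F N θ₀.ν θ₀.τ9.M _ p.K s.init U₀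
  · exact chiSeqOfRecord_eq_one_of_Omega_empty F N θ₀.ν θ₀.τ9.M _ p.K k s.init (init_allLarge θ₀ p s hall k hkpos le_rfl) U₀

/-- **`hA` ALONG AN ALL-`Ω`-EMPTY OLD TERM**: the (2.23) action of `init s′` is `−g₀⁻²A(U) − E` for EVERY fluctuation argument (p495297), hence `k`-local in it —
for every setting, residual and witness (`M ≥ 1`). [cite: Balaban1988Convergent, (2.23)–(2.25) pp.258–259] -/
theorem hA_of_allLarge (hM : 1 ≤ θ₀.τ9.M) {k : ℕ} (s : SeqOfRecord F θ₀.ν θ₀.τ9.M (gOfRecord₁₃ F N θ₀ p) p.K (k + 1))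
    (hall : ∀ j, 1 ≤ j → j ≤ k + 1 → s.Ω j = ∅) (S' : Sect2.Setting (MatA N) (SU N)) (Rz : Sect2.Residual (F.P p.K) (MatA N))
    (t : Sect2.TermValues (F.P p.K) (MatA N) (FluctV N) θ₀.τ9.M) (E₀ : ℝ) :
    ∀ (S : ℕ → Set (Site (F.P p.K) 0)) (a a' : Tk.MSFluct (F.P p.K) (FluctV N)) (Uf : GaugeField (F.P p.K) 0 (SU N)), (∀ i, i ≤ k → a i = a' i) →
      (sect2ActionDataOfRecord F N (FluctV N) p.K S' Rz s.init t (S, a) E₀).action23 k Uf =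
        (sect2ActionDataOfRecord F N (FluctV N) p.K S' Rz s.init t (S, a') E₀).action23 k Uf := fun S a a' Uf _ => by
  rw [action23_of_forall_Omega_empty S' Rz hM s.init (init_allLarge θ₀ p s hall) t (S, a) E₀ Uf,
    action23_of_forall_Omega_empty S' Rz hM s.init (init_allLarge θ₀ p s hall) t (S, a') E₀ Uf]

/-- **★ THE GENERAL-HISTORY STEP SPECIALISES TO THE DIAGONAL AT THE DOOR OF K0a's CURED WITNESS — ALL PINS AND LOCALITIES DISCHARGED.**  At
`θ := Stage13HParams.ofHistoryBlind (Stage13RParams.ofCured θ₀)` and the all-large-field new sequence `s′` of length `k+1` (`k < K`, `1 ≤ M`, `θ₀.Provisos₁₃Core`):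
p544575's `exists_clause_succ_CoPH_of_Omega_empty_of_sLaw₁₃CoPH` applies with (P) by `rfl`, (V) by `ZrOfRecord₁₃_ζ0_univ_pairCfgAt` and `χ_k(init s′) ≡ 1`, `hq`∕`hqloc`
by `ZrOfRecord₁₃_quad`, `hloc` by `zhLocal` of the door provisos, `hA` by the term-free action — leaving `SLaw₁₃CoPH θ p k` and the displayed measurability ∕ bound of
the new integrand. [cite: Balaban1988Convergent, Theorem p.245, (3.24)–(3.25) p.270, (2.18) p.257, (2.20)–(2.25) pp.258–259, (1.11) p.248] -/
theorem exists_clause_succ_CoPH_door_ofCured_of_allLarge (h : θ₀.Provisos₁₃Core F N) {k : ℕ} (hk : k < p.K) (hM : 1 ≤ θ₀.τ9.M)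
    (hS : SLaw₁₃CoPH F N (Stage13HParams.ofHistoryBlind F N (Stage13RParams.ofCured F N θ₀)) p k)
    (s : SeqOfRecord F θ₀.ν θ₀.τ9.M (gOfRecord₁₃ F N θ₀ p) p.K (k + 1)) (hall : ∀ j, 1 ≤ j → j ≤ k + 1 → s.Ω j = ∅)
    {C : ℝ}
    (hm : ∀ (t₀ : Sect2.TermValues (F.P p.K) (MatA N) (FluctV N) θ₀.τ9.M) (E₀ : ℝ),
      ∀ S ∈ admSOfRecord F θ₀.ν θ₀.τ9.M (gOfRecord₁₃ F N θ₀ p) p.K k s.init,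
      Measurable (Function.uncurry (noExpIntegrandAt F N (FluctV N) p.K k
        (WtOfRecord₁₃H F N (Stage13HParams.ofHistoryBlind F N (Stage13RParams.ofCured F N θ₀)) p s)
        (tkBranchOfRecord F N (FluctV N) θ₀.ν θ₀.τ9.M _ p.K (WtOfRecord₁₃H F N (Stage13HParams.ofHistoryBlind F N (Stage13RParams.ofCured F N θ₀)) p s)
          s.init S k
          (fun ω => sect2Operand F N (FluctV N) p.K (settingOfRecord₁₃ F N θ₀ p)
            ((Stage13HParams.ofHistoryBlind F N (Stage13RParams.ofCured F N θ₀)).rzAt p s) s t₀ E₀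
            (UbgOfRecord₁₃CoP F N θ₀ p (k + 1) s) (S, fun j => (ω j).2) (fun j => (ω j).1))))))
    (hC : ∀ (t₀ : Sect2.TermValues (F.P p.K) (MatA N) (FluctV N) θ₀.τ9.M) (E₀ : ℝ),
      ∀ S ∈ admSOfRecord F θ₀.ν θ₀.τ9.M (gOfRecord₁₃ F N θ₀ p) p.K k s.init, ∀ V' U₀,
      |noExpIntegrandAt F N (FluctV N) p.K k (WtOfRecord₁₃H F N (Stage13HParams.ofHistoryBlind F N (Stage13RParams.ofCured F N θ₀)) p s)
        (tkBranchOfRecord F N (FluctV N) θ₀.ν θ₀.τ9.M _ p.K (WtOfRecord₁₃H F N (Stage13HParams.ofHistoryBlind F N (Stage13RParams.ofCured F N θ₀)) p s)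
          s.init S k
          (fun ω => sect2Operand F N (FluctV N) p.K (settingOfRecord₁₃ F N θ₀ p)
            ((Stage13HParams.ofHistoryBlind F N (Stage13RParams.ofCured F N θ₀)).rzAt p s) s t₀ E₀
            (UbgOfRecord₁₃CoP F N θ₀ p (k + 1) s) (S, fun j => (ω j).2) (fun j => (ω j).1)))
        V' U₀| ≤ C) :
    ∃ (t₀ : Sect2.TermValues (F.P p.K) (MatA N) (FluctV N) θ₀.τ9.M) (E' : ℝ),
      slotsTOfRecord F N θ₀.ν θ₀.τ9 (EOfRecord₁₃ F N θ₀) (wOfRecord₉ F N θ₀.toStage9Params) θ₀.ppSel p (gOfRecord₁₃ F N θ₀ p) (k + 1) s = 0 ∨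
        ∀ᵐ V' ∂fieldMeasure (F.P p.K) (k + 1) (SU N),
          chiSeqOfRecord F N θ₀.ν θ₀.τ9.M (gOfRecord₁₃ F N θ₀ p) p.K (k + 1) s V' ≠ 0 →
            slotsTOfRecord F N θ₀.ν θ₀.τ9 (EOfRecord₁₃ F N θ₀) (wOfRecord₉ F N θ₀.toStage9Params) θ₀.ppSel p (gOfRecord₁₃ F N θ₀ p) (k + 1) s V' =
              sect2Slot F N (FluctV N) p.K (settingOfRecord₁₃ F N θ₀ p)
                ((Stage13HParams.ofHistoryBlind F N (Stage13RParams.ofCured F N θ₀)).rzAt p s)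
                (WtOfRecord₁₃H F N (Stage13HParams.ofHistoryBlind F N (Stage13RParams.ofCured F N θ₀)) p s) s t₀ E'
                (UbgOfRecord₁₃CoP F N θ₀ p (k + 1) s) V' := by
  obtain rfl : s = seqAllLargeOfRecord F θ₀.ν θ₀.τ9.M (gOfRecord₁₃ F N θ₀ p) p.K (k + 1) :=
    BalabanUVNodesN11ResidualPinCompletion.seq_eq_seqAllLargeOfRecord θ₀.ν θ₀.τ9.M _ p.K (k + 1) s hall
  refine exists_clause_succ_CoPH_of_Omega_empty_of_sLaw₁₃CoPH (Stage13HParams.ofHistoryBlind F N (Stage13RParams.ofCured F N θ₀)) p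
    h.ofCured.ofHistoryBlind hk hM hS _ (hall (k + 1) (Nat.succ_pos k) le_rfl) (fun j _ ω ω' _ => ?_) (fun _ _ => ⟨rfl, rfl⟩)
    (fun t₀ E₀ => hA_of_allLarge θ₀ p hM _ hall _ _ t₀ E₀) (fun V' U₀ => ?_) (fun V' U₀ => ?_) hm hC
  · -- `hqloc`: the cured residual's `quad` is identically `0`
    show (ZrOfRecord₁₃ F N θ₀ p).quad j _ ω = (ZrOfRecord₁₃ F N θ₀ p).quad j _ ω'
    rw [ZrOfRecord₁₃_quad, ZrOfRecord₁₃_quad]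
  · -- (V): K0a's generation-`k` pin face; the old front factor is `1` along the diagonal
    show (ZrOfRecord₁₃ F N θ₀ p).ζ0 k Set.univ (pairCfgAt (V := FluctV N) k V' U₀) =
      chiSeqOfRecord F N θ₀.ν θ₀.τ9.M (gOfRecord₁₃ F N θ₀ p) p.K k
          (seqAllLargeOfRecord F θ₀.ν θ₀.τ9.M (gOfRecord₁₃ F N θ₀ p) p.K (k + 1)).init U₀ *
        wOfRecord₉ F N θ₀.toStage9Params p (gOfRecord₁₃ F N θ₀ p) k (seqAllLargeOfRecord F θ₀.ν θ₀.τ9.M (gOfRecord₁₃ F N θ₀ p) p.K (k + 1)) U₀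
          ((avOfRecord F N p.K k).avg U₀)
    rw [chiSeqOfRecord_init_eq_one_of_allLarge θ₀ p _ hall U₀, one_mul]
    exact ZrOfRecord₁₃_ζ0_univ_pairCfgAt hk V' U₀
  · show (ZrOfRecord₁₃ F N θ₀ p).quad k ∅ (pairCfgAt (V := FluctV N) k V' U₀) = 0
    rw [ZrOfRecord₁₃_quad]

end Door

end Summit.QuantumFields.YangMills.Theorems.BalabanUVNodesN11NoExpansionGeneralStepCoPHDoor

end
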